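import Summits.HodgeConjecture.HodgeConjecture.Theorems.AnchorTransportVariationalHodgePadicQPCompositionSQP
import Summits.HodgeConjecture.HodgeConjecture.Theorems.AnchorTransportVariationalHodgePadicDiscSupply
import Summits.HodgeConjecture.HodgeConjecture.Theorems.AnchorTransportVariationalHodgePadicFamilyModel
import Literature.AlgebraicGeometry.Limits.SmoothProjectiveFamilyModelBaseChange

/-!
# Route AnchorTransport — crux `VariationalHodge` (stmt-HodgeConjecture-1076), line `padic-disc-transport`:
# STUB S reduced to its TRANSPORT CORE on quasi-projective carriers — `P ∧ T ⟹ VariationalHodgeQP`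

HONEST FRAMING: research route conditional on HC_CM; not a corollary; Q11.4-sentence-2 already refuted in dim ≥ 3.
Helper file on the crux item (nothing here closes it; no definition, no named fact, no `sorry`;
`HC_CM` does not occur). Cell `pub-hodge-ring2`, binder seat `ring2-b03` (gen 36), BINDER-OWNERS row b03.

STUB S (`PadicDiscTransport.ArithmeticDiscSupply`, the "Maulik–Poonen disc") bundles the ARITHMETIC DISC
(a `q`-adic model of a `k`-generic fibre in the residue disc of the anchor — classical, PROVED in the
kernel on quasi-projective carriers by gens 33–36 of this seat) and the TRANSPORT (the pro-class `ξ̂`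
lifting the reduction of the anchor cycle and the implication "`ξ̂|_{Y_κ}` algebraizes ⟹ `A|_{X_s}`
algebraic": Berthelot–Ogus across the disc, Bloch–Esnault–Kerz Thm. 1.3, Chern characters — NOT
formalised; it needs a crystalline ↔ de Rham ↔ Betti comparison package the tree does not have). This
file isolates the transport as an explicit hypothesis `T` with the quantifier order its proof needs:
GIVEN a smooth projective model of the family over a smooth affine model `Spec B → Spec R` of the base,
the transport may first ask for finitely many complex scalars `F` to be adjoined to `R` (the field of
definition of the anchor CYCLE relative to the model depends on the model), and is then owed on every
ENLARGED model (`R → R'`, `F ⊆ image of R' → ℂ`, `B' = R' ⊗_R B`, `Y' = Y ×_B B'`, with its comparison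
maps) and every `q`-adic disc datum on it (Witt points `β₀, β : B' → W(𝔽̄_q)` with the same reduction,
`ι : K → ℂ` with `ι ∘ β₀ = s₀`, `ι ∘ β = s`): a pro-class `ξ̂` on `𝒴 = Y' ⊗_β W` whose algebraization
implies that `A|_{X_s}` is algebraic.

* `arithmeticDiscSupplyQP_of_transport` — **`T ⟹ S` on quasi-projective carriers** (`S_QP`): model
  (`padicFamilyModel_of_isQuasiProjectiveOver`), enlargement by `F`
  (`Limits.smooth_projective_family_model_baseChange_comparison`), disc on the enlarged model
  (`HodgeTheory.exists_wittVector_points_same_reduction_generic`), `W(κ)`-model of the generic fibre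
  (`Motives.isSmoothProperModel_baseChange_wittVector`), and the pro-class from `T`;
* `variationalHodgeQP_of_padic_of_transport` — **`P ∧ T ⟹ Ring2.Hypotheses.VariationalHodgeQP`** (through
  `variationalHodgeQP_of_padicQP`; the `FlatSectionsAlgebraicQP` form follows by
  `Ring2.Hypotheses.flatSectionsAlgebraicQP_of_variationalHodgeQP`).
-/

noncomputable section

-- every declaration of this problem lives in `Summit.HodgeConjecture.HodgeConjecture.…` (summit = sub-problem)
set_option linter.dupNamespace false

open CategoryTheory CategoryTheory.Limits AlgebraicGeometry TopologicalSpace MonoidalCategory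
open Literature.AlgebraicGeometry.Motives Literature.AlgebraicGeometry.HodgeTheory
open Literature.AlgebraicGeometry.KTheory Literature.AlgebraicGeometry.Crystalline
open Summit.HodgeConjecture.HodgeConjecture.Theses.AnchorTransport
open scoped Isocrystal

namespace Summit.HodgeConjecture.HodgeConjecture.Theorems

section Transport

-- T: the TRANSPORT across one `q`-adic disc, with the quantifier order its proof requires (see the
-- module docstring): data, class, anchor; model; ∃ F; enlarged model with comparison maps; disc; ∃ ξ̂.
variable
  (hT : ∀ (k : Type) [Field k] [Countable k] (σ : k →+* ℂ) ⦃n : ℕ⦄ ⦃𝒳₀ S₀ : SchemeOver k⦄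
    (f₀ : 𝒳₀ ⟶ S₀), IsSmoothProjectiveFamily ((baseChangeHom σ).map f₀) n →
    IrreducibleSpace ((baseChangeHom σ).obj S₀).left → IsAffine ((baseChangeHom σ).obj S₀).left →
    AlgebraicGeometry.Smooth ((baseChangeHom σ).obj S₀).hom →
    topologicalKrullDim ((baseChangeHom σ).obj S₀).left = 1 →
    ∀ (p : ℕ) (A : complexBetti ((baseChangeHom σ).obj 𝒳₀) (2 * p)),
    (∀ s : ComplexPoints ((baseChangeHom σ).obj S₀),
      IsRationalClass (complexBetti.map (fiberι ((baseChangeHom σ).map f₀) s) (2 * p) A) ∧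
      IsOfHodgeType n (fiberOver ((baseChangeHom σ).map f₀) s) (2 * p) p p
        (complexBetti.map (fiberι ((baseChangeHom σ).map f₀) s) (2 * p) A)) →
    ∀ s₀ : ComplexPoints ((baseChangeHom σ).obj S₀),
      complexBetti.map (fiberι ((baseChangeHom σ).map f₀) s₀) (2 * p) A ∈
        algebraicClasses (fiberOver ((baseChangeHom σ).map f₀) s₀) p →
    -- a smooth projective model of the family over a smooth affine model of the base
    ∀ (M : ℕ) (R B : Type) [CommRing R] [CommRing B] [Algebra R B] [Algebra.FiniteType ℤ R]
      [Algebra.FiniteType R B]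
      [SmoothOfRelativeDimension 1 (Spec.map (CommRingCat.ofHom (algebraMap R B)))]
      (τ : R →+* ℂ) (πS : ((baseChangeHom σ).obj S₀).left ⟶ Spec (.of B)),
      IsPullback πS ((baseChangeHom σ).obj S₀).hom
        (Spec.map (CommRingCat.ofHom (algebraMap R B))) (Spec.map (CommRingCat.ofHom τ)) →
    ∀ (Y : Scheme.{0}) (g : Y ⟶ Spec (.of B))
      (emb : letI := MvPolynomial.gradedAlgebra (σ := Fin (M + 1)) (R := B)
        Y ⟶ Proj (MvPolynomial.homogeneousSubmodule (Fin (M + 1)) B)),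
      IsClosedImmersion emb →
      (letI := MvPolynomial.gradedAlgebra (σ := Fin (M + 1)) (R := B)
      emb ≫ ProjBaseChangeRing.projToSpec (Fin (M + 1)) B = g) →
      IsProper g → SmoothOfRelativeDimension n g →
    ∀ (π𝒳 : ((baseChangeHom σ).obj 𝒳₀).left ⟶ Y),
      IsPullback π𝒳 ((baseChangeHom σ).map f₀).left g πS →
    -- the transport may ask for finitely many scalars to be adjoined to the model ring …
    ∃ F : Finset ℂ,
    -- … and is then owed on every enlargement of the model containing them
    ∀ (R' B' : Type) [CommRing R'] [CommRing B'] [Algebra R' B'] [Algebra R R'] [Algebra B B']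
      [Algebra.FiniteType ℤ R'] [Algebra.FiniteType R' B']
      [SmoothOfRelativeDimension 1 (Spec.map (CommRingCat.ofHom (algebraMap R' B')))]
      (τ' : R' →+* ℂ), τ'.comp (algebraMap R R') = τ → (∀ x ∈ F, x ∈ Set.range τ') →
      IsPullback (Spec.map (CommRingCat.ofHom (algebraMap B B')))
        (Spec.map (CommRingCat.ofHom (algebraMap R' B')))
        (Spec.map (CommRingCat.ofHom (algebraMap R B)))
        (Spec.map (CommRingCat.ofHom (algebraMap R R'))) →
    ∀ (πS' : ((baseChangeHom σ).obj S₀).left ⟶ Spec (.of B')),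
      IsPullback πS' ((baseChangeHom σ).obj S₀).hom
        (Spec.map (CommRingCat.ofHom (algebraMap R' B'))) (Spec.map (CommRingCat.ofHom τ')) →
      πS' ≫ Spec.map (CommRingCat.ofHom (algebraMap B B')) = πS →
    ∀ (Y' : Scheme.{0}) (g' : Y' ⟶ Spec (.of B'))
      (emb' : letI := MvPolynomial.gradedAlgebra (σ := Fin (M + 1)) (R := B')
        Y' ⟶ Proj (MvPolynomial.homogeneousSubmodule (Fin (M + 1)) B')),
      IsClosedImmersion emb' →
      (letI := MvPolynomial.gradedAlgebra (σ := Fin (M + 1)) (R := B')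
      emb' ≫ ProjBaseChangeRing.projToSpec (Fin (M + 1)) B' = g') →
      IsProper g' → SmoothOfRelativeDimension n g' →
    ∀ (ρ : Y' ⟶ Y), IsPullback ρ g' g (Spec.map (CommRingCat.ofHom (algebraMap B B'))) →
      (letI := MvPolynomial.gradedAlgebra (σ := Fin (M + 1)) (R := B)
      letI := MvPolynomial.gradedAlgebra (σ := Fin (M + 1)) (R := B')
      emb' ≫ Proj.map _ (ProjBaseChangeRing.irrelevant_le_map B B' (Fin (M + 1))) = ρ ≫ emb) →
    ∀ (π𝒳' : ((baseChangeHom σ).obj 𝒳₀).left ⟶ Y'),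
      IsPullback π𝒳' ((baseChangeHom σ).map f₀).left g' πS' → π𝒳' ≫ ρ = π𝒳 →
    -- the `q`-adic disc of the anchor on the enlarged model
    ∀ (q : ℕ) [Fact q.Prime] (κ : Type) [Field κ] [CharP κ q] [PerfectRing κ q] [IsAlgClosed κ]
      [Algebra (ZMod q) κ], Algebra.IsAlgebraic (ZMod q) κ →
    ∀ (β₀ β : B' →+* WittVector q κ) (ι' : K(q, κ) →+* ℂ)
      (s : ComplexPoints ((baseChangeHom σ).obj S₀)),
      n + 6 < q →
      β₀.comp (algebraMap R' B') = β.comp (algebraMap R' B') →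
      (WittVector.constantCoeff : WittVector q κ →+* κ).comp β₀ =
        (WittVector.constantCoeff : WittVector q κ →+* κ).comp β →
      ((ι'.comp (algebraMap (WittVector q κ) K(q, κ))).comp β₀).comp (algebraMap R' B') = τ' →
      s₀.left ≫ πS' =
        Spec.map (CommRingCat.ofHom ((ι'.comp (algebraMap (WittVector q κ) K(q, κ))).comp β₀)) →
      s.left ≫ πS' =
        Spec.map (CommRingCat.ofHom ((ι'.comp (algebraMap (WittVector q κ) K(q, κ))).comp β)) →
    -- the transport: a pro-class on the `W(κ)`-model of `X_s` whose algebraization settles `A|_{X_s}`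
    ∃ ξ : ContinuousKZeroRat (Ideal.span {(q : WittVector q κ)})
        (Over.mk (pullback.snd g' (Spec.map (CommRingCat.ofHom β))) : SchemeOver (WittVector q κ)),
      (∃ η : KZeroRat (pullback g' (Spec.map (CommRingCat.ofHom β))),
        KZeroRat.map (WittScheme.specialFibreι
          (Over.mk (pullback.snd g' (Spec.map (CommRingCat.ofHom β))) : SchemeOver (WittVector q κ)))
            η =
          KZeroRat.map (specialFibreToTower
            (Over.mk (pullback.snd g' (Spec.map (CommRingCat.ofHom β))) : SchemeOver (WittVector q κ)))
            (ContinuousKZeroRat.specialFibre (Ideal.span {(q : WittVector q κ)})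
              (Over.mk (pullback.snd g' (Spec.map (CommRingCat.ofHom β))) :
                SchemeOver (WittVector q κ)) ξ)) →
      complexBetti.map (fiberι ((baseChangeHom σ).map f₀) s) (2 * p) A ∈
        algebraicClasses (fiberOver ((baseChangeHom σ).map f₀) s) p)

include hT

/-- **`T ⟹ S` on quasi-projective carriers.** STUB S (`ArithmeticDiscSupply`, `IsGenericPoint` /
`ProClassAlgebraizes` unfolded) with the extra binder `IsQuasiProjectiveOver (𝒳₀ ⊗_σ ℂ)` follows from
the transport `T`: spread the family out (`padicFamilyModel_of_isQuasiProjectiveOver`), let `T` name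
its scalars `F`, enlarge the model ring to `R[F] ⊆ ℂ` with the comparison maps
(`Limits.smooth_projective_family_model_baseChange_comparison`), take the `q`-adic residue disc of the
anchor on the enlarged base model with a `k`-GENERIC partner
(`HodgeTheory.exists_wittVector_points_same_reduction_generic`, Maulik–Poonen 2012 §4), the
`W(κ)`-model `𝒴 = Y' ⊗_β W(κ)` of the generic fibre (`Motives.isSmoothProperModel_baseChange_wittVector`),
and the pro-class with its implication from `T`. [cite: MaulikPoonen2012, §4] -/
theorem arithmeticDiscSupplyQP_of_transport (N : ℕ) (k : Type) [Field k] [Countable k]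
    (σ : k →+* ℂ) ⦃n : ℕ⦄ ⦃𝒳₀ S₀ : SchemeOver k⦄ (f₀ : 𝒳₀ ⟶ S₀)
    (h𝒳 : IsQuasiProjectiveOver ((baseChangeHom σ).obj 𝒳₀))
    (hf : IsSmoothProjectiveFamily ((baseChangeHom σ).map f₀) n)
    (hirr : IrreducibleSpace ((baseChangeHom σ).obj S₀).left)
    (haff : IsAffine ((baseChangeHom σ).obj S₀).left)
    (hsm : AlgebraicGeometry.Smooth ((baseChangeHom σ).obj S₀).hom)
    (hdim : topologicalKrullDim ((baseChangeHom σ).obj S₀).left = 1)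
    (p : ℕ) (A : complexBetti ((baseChangeHom σ).obj 𝒳₀) (2 * p))
    (hA : ∀ s : ComplexPoints ((baseChangeHom σ).obj S₀),
      IsRationalClass (complexBetti.map (fiberι ((baseChangeHom σ).map f₀) s) (2 * p) A) ∧
      IsOfHodgeType n (fiberOver ((baseChangeHom σ).map f₀) s) (2 * p) p p
        (complexBetti.map (fiberι ((baseChangeHom σ).map f₀) s) (2 * p) A))
    (s₀ : ComplexPoints ((baseChangeHom σ).obj S₀))
    (hs₀ : complexBetti.map (fiberι ((baseChangeHom σ).map f₀) s₀) (2 * p) A ∈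
      algebraicClasses (fiberOver ((baseChangeHom σ).map f₀) s₀) p) :
    ∃ (q : ℕ) (_ : Fact q.Prime) (κ : Type) (_ : Field κ) (_ : CharP κ q) (_ : PerfectRing κ q)
      (_ : IsAlgClosed κ) (_ : Algebra (ZMod q) κ) (_ : Algebra.IsAlgebraic (ZMod q) κ)
      (𝒴 : SchemeOver (WittVector q κ))
      (ξ : ContinuousKZeroRat (Ideal.span {(q : WittVector q κ)}) 𝒴)
      (s : ComplexPoints ((baseChangeHom σ).obj S₀)) (ι : K(q, κ) →+* ℂ),
      N ≤ q ∧ WittScheme.IsSmoothProperModel n 𝒴 ∧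
      (∀ Z : Set (ComplexPoints ((baseChangeHom σ).obj S₀)),
        IsDefinedOver σ S₀ σ.fieldRange Z → s ∈ Z → Z = Set.univ) ∧
      Nonempty ((baseChangeHom ι).obj (WittScheme.genericFibre 𝒴) ≅
        fiberOver ((baseChangeHom σ).map f₀) s) ∧
      ((∃ η : KZeroRat 𝒴.left,
        KZeroRat.map (WittScheme.specialFibreι 𝒴) η =
          KZeroRat.map (specialFibreToTower 𝒴)
            (ContinuousKZeroRat.specialFibre (Ideal.span {(q : WittVector q κ)}) 𝒴 ξ)) →
        complexBetti.map (fiberι ((baseChangeHom σ).map f₀) s) (2 * p) A ∈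
          algebraicClasses (fiberOver ((baseChangeHom σ).map f₀) s) p) := by
  classical
  haveI := hirr
  haveI := haff
  haveI : LocallyOfFiniteType ((baseChangeHom σ).obj S₀).hom := by
    haveI : Smooth ((baseChangeHom σ).obj S₀).hom := hsm
    infer_instance
  -- (1) a smooth projective model of the family
  obtain ⟨M, R, B, _, _, _, _, _, hBd, τ, πS, hπS, Y, g, emb, hemb, hembg, π𝒳, hgP, hgn, h𝒳⟩ :=
    padicFamilyModel_of_isQuasiProjectiveOver ((baseChangeHom σ).map f₀) hf hsm hdim h𝒳
  haveI := hBd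
  haveI := hgP
  -- (2) the scalars the transport wants
  obtain ⟨F, hF⟩ := hT k σ f₀ hf hirr haff hsm hdim p A hA s₀ hs₀ M R B τ πS hπS Y g emb hemb hembg
    hgP hgn π𝒳 h𝒳
  -- (3) the enlarged model `R' = R[F] ⊆ ℂ` with its comparison maps
  letI algRC : Algebra R ℂ := τ.toAlgebra
  obtain ⟨R', _, _, _, _, hR'ft, hFR'⟩ : ∃ (R' : Type) (_ : CommRing R') (_ : Algebra R R')
      (_ : Algebra R' ℂ) (_ : IsScalarTower R R' ℂ),
      Algebra.FiniteType R R' ∧ ∀ x ∈ F, x ∈ Set.range (algebraMap R' ℂ) :=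
    ⟨Algebra.adjoin R (F : Set ℂ), inferInstance, inferInstance, inferInstance, inferInstance,
      (Subalgebra.fg_iff_finiteType _).mp ⟨F, rfl⟩,
      fun x hx => ⟨⟨x, Algebra.subset_adjoin (by exact_mod_cast hx)⟩, rfl⟩⟩
  haveI : Algebra.FiniteType ℤ R' :=
    Algebra.FiniteType.trans (inferInstance : Algebra.FiniteType ℤ R) hR'ft
  have hτ' : (algebraMap R' ℂ).comp (algebraMap R R') = τ := (IsScalarTower.algebraMap_eq R R' ℂ).symm
  have hπS₀ : IsPullback πS ((baseChangeHom σ).obj S₀).hom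
      (Spec.map (CommRingCat.ofHom (algebraMap R B))) (Spec.map (CommRingCat.ofHom (algebraMap R ℂ))) :=
    hπS
  obtain ⟨B', _, _, _, hB'ft, πS', Y', g', emb', hemb', hembg', π𝒳', ρ, hBd', hπS', hgP', hgn', h𝒳',
    sqB, sqY, hembρ, hπ'π, hπ𝒳'ρ⟩ :=
    Literature.AlgebraicGeometry.Limits.smooth_projective_family_model_baseChange_comparison
      (K := ℂ) (R' := R') ((baseChangeHom σ).obj S₀) ((baseChangeHom σ).map f₀) πS g emb
      hembg π𝒳 hBd hπS₀ hgn h𝒳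
  haveI := hBd'
  haveI := hgP'
  -- (4) the `q`-adic disc of the anchor on the enlarged base model, with a `k`-generic partner
  obtain ⟨q, hq, κ, _, _, _, _, _, hκalg, β₀, β, ι', s, hNq, hR, hred, hτ, hs₀', hs', hgen⟩ :=
    exists_wittVector_points_same_reduction_generic σ S₀ (algebraMap R' ℂ) πS' hπS' (le_of_eq hdim)
      s₀ (max N (n + 7))
  haveI := hq
  have hnq : n + 6 < q := by have := (le_max_right N (n + 7)).trans hNq; omega
  -- (5) the `W(κ)`-model of the generic fibre `X_s`
  have HX := isPullback_fiberOver_of_model ((baseChangeHom σ).map f₀) g' πS' π𝒳' h𝒳' s _ hs'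
  letI := MvPolynomial.gradedAlgebra (σ := Fin (M + 1)) (R := B')
  obtain ⟨-, -, -, h𝒴, hiso⟩ := isSmoothProperModel_baseChange_wittVector emb' hemb' hembg' hgP' hgn'
    β ι' (hf.isSmoothProjective s) _ HX
  -- (6) the pro-class and the transport
  obtain ⟨ξ, hξ⟩ := hF R' B' (algebraMap R' ℂ) hτ' hFR' sqB πS' hπS' hπ'π Y' g' emb' hemb' hembg'
    hgP' hgn' ρ sqY hembρ π𝒳' h𝒳' hπ𝒳'ρ q κ hκalg β₀ β ι' s hnq hR hred hτ hs₀' hs'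
  exact ⟨q, hq, κ, inferInstance, inferInstance, inferInstance, inferInstance, inferInstance, hκalg,
    Over.mk (pullback.snd g' (Spec.map (CommRingCat.ofHom β))), ξ, s, ι', (le_max_left _ _).trans hNq,
    h𝒴, hgen, hiso, hξ⟩

omit hT in
/-- **`P ∧ T ⟹ Ring2.Hypotheses.VariationalHodgeQP`**: on quasi-projective carriers the line
`padic-disc-transport` reduces the variational Hodge conjecture to the p-adic image-algebraization bet
`P` (AMMN 2022 Conj. 1.3, `K₀`-form) and the transport `T` across ONE `q`-adic disc — the arithmetic
disc itself being proved (`variationalHodgeQP_of_padicQP` with `S_QP` from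
`arithmeticDiscSupplyQP_of_transport`). [cite: AntieauMathewMorrowNikolaus2022, Conj. 1.3 and Thm. D]
[cite: CharlesSchnell2014Notes, Conj. 11.3.1] [cite: MaulikPoonen2012, §4] -/
theorem variationalHodgeQP_of_padic_of_transport
    (hP : ∀ d : ℕ, ∃ p₀ : ℕ, ∀ (p : ℕ) [Fact p.Prime], p₀ ≤ p →
      ∀ (κ : Type) [Field κ] [CharP κ p] [PerfectRing κ p] [IsAlgClosed κ] [Algebra (ZMod p) κ],
      Algebra.IsAlgebraic (ZMod p) κ →
      ∀ (𝒴 : SchemeOver (WittVector p κ)), WittScheme.IsSmoothProperModel d 𝒴 →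
      ∀ ξ : ContinuousKZeroRat (Ideal.span {(p : WittVector p κ)}) 𝒴,
        ∃ η : KZeroRat 𝒴.left,
          KZeroRat.map (WittScheme.specialFibreι 𝒴) η =
            KZeroRat.map (specialFibreToTower 𝒴)
              (ContinuousKZeroRat.specialFibre (Ideal.span {(p : WittVector p κ)}) 𝒴 ξ))
    (hT : ∀ (k : Type) [Field k] [Countable k] (σ : k →+* ℂ) ⦃n : ℕ⦄ ⦃𝒳₀ S₀ : SchemeOver k⦄
    (f₀ : 𝒳₀ ⟶ S₀), IsSmoothProjectiveFamily ((baseChangeHom σ).map f₀) n →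
    IrreducibleSpace ((baseChangeHom σ).obj S₀).left → IsAffine ((baseChangeHom σ).obj S₀).left →
    AlgebraicGeometry.Smooth ((baseChangeHom σ).obj S₀).hom →
    topologicalKrullDim ((baseChangeHom σ).obj S₀).left = 1 →
    ∀ (p : ℕ) (A : complexBetti ((baseChangeHom σ).obj 𝒳₀) (2 * p)),
    (∀ s : ComplexPoints ((baseChangeHom σ).obj S₀),
      IsRationalClass (complexBetti.map (fiberι ((baseChangeHom σ).map f₀) s) (2 * p) A) ∧
      IsOfHodgeType n (fiberOver ((baseChangeHom σ).map f₀) s) (2 * p) p p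
        (complexBetti.map (fiberι ((baseChangeHom σ).map f₀) s) (2 * p) A)) →
    ∀ s₀ : ComplexPoints ((baseChangeHom σ).obj S₀),
      complexBetti.map (fiberι ((baseChangeHom σ).map f₀) s₀) (2 * p) A ∈
        algebraicClasses (fiberOver ((baseChangeHom σ).map f₀) s₀) p →
    -- a smooth projective model of the family over a smooth affine model of the base
    ∀ (M : ℕ) (R B : Type) [CommRing R] [CommRing B] [Algebra R B] [Algebra.FiniteType ℤ R]
      [Algebra.FiniteType R B]
      [SmoothOfRelativeDimension 1 (Spec.map (CommRingCat.ofHom (algebraMap R B)))]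
      (τ : R →+* ℂ) (πS : ((baseChangeHom σ).obj S₀).left ⟶ Spec (.of B)),
      IsPullback πS ((baseChangeHom σ).obj S₀).hom
        (Spec.map (CommRingCat.ofHom (algebraMap R B))) (Spec.map (CommRingCat.ofHom τ)) →
    ∀ (Y : Scheme.{0}) (g : Y ⟶ Spec (.of B))
      (emb : letI := MvPolynomial.gradedAlgebra (σ := Fin (M + 1)) (R := B)
        Y ⟶ Proj (MvPolynomial.homogeneousSubmodule (Fin (M + 1)) B)),
      IsClosedImmersion emb →
      (letI := MvPolynomial.gradedAlgebra (σ := Fin (M + 1)) (R := B)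
      emb ≫ ProjBaseChangeRing.projToSpec (Fin (M + 1)) B = g) →
      IsProper g → SmoothOfRelativeDimension n g →
    ∀ (π𝒳 : ((baseChangeHom σ).obj 𝒳₀).left ⟶ Y),
      IsPullback π𝒳 ((baseChangeHom σ).map f₀).left g πS →
    -- the transport may ask for finitely many scalars to be adjoined to the model ring …
    ∃ F : Finset ℂ,
    -- … and is then owed on every enlargement of the model containing them
    ∀ (R' B' : Type) [CommRing R'] [CommRing B'] [Algebra R' B'] [Algebra R R'] [Algebra B B']
      [Algebra.FiniteType ℤ R'] [Algebra.FiniteType R' B']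
      [SmoothOfRelativeDimension 1 (Spec.map (CommRingCat.ofHom (algebraMap R' B')))]
      (τ' : R' →+* ℂ), τ'.comp (algebraMap R R') = τ → (∀ x ∈ F, x ∈ Set.range τ') →
      IsPullback (Spec.map (CommRingCat.ofHom (algebraMap B B')))
        (Spec.map (CommRingCat.ofHom (algebraMap R' B')))
        (Spec.map (CommRingCat.ofHom (algebraMap R B)))
        (Spec.map (CommRingCat.ofHom (algebraMap R R'))) →
    ∀ (πS' : ((baseChangeHom σ).obj S₀).left ⟶ Spec (.of B')),
      IsPullback πS' ((baseChangeHom σ).obj S₀).hom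
        (Spec.map (CommRingCat.ofHom (algebraMap R' B'))) (Spec.map (CommRingCat.ofHom τ')) →
      πS' ≫ Spec.map (CommRingCat.ofHom (algebraMap B B')) = πS →
    ∀ (Y' : Scheme.{0}) (g' : Y' ⟶ Spec (.of B'))
      (emb' : letI := MvPolynomial.gradedAlgebra (σ := Fin (M + 1)) (R := B')
        Y' ⟶ Proj (MvPolynomial.homogeneousSubmodule (Fin (M + 1)) B')),
      IsClosedImmersion emb' →
      (letI := MvPolynomial.gradedAlgebra (σ := Fin (M + 1)) (R := B')
      emb' ≫ ProjBaseChangeRing.projToSpec (Fin (M + 1)) B' = g') →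
      IsProper g' → SmoothOfRelativeDimension n g' →
    ∀ (ρ : Y' ⟶ Y), IsPullback ρ g' g (Spec.map (CommRingCat.ofHom (algebraMap B B'))) →
      (letI := MvPolynomial.gradedAlgebra (σ := Fin (M + 1)) (R := B)
      letI := MvPolynomial.gradedAlgebra (σ := Fin (M + 1)) (R := B')
      emb' ≫ Proj.map _ (ProjBaseChangeRing.irrelevant_le_map B B' (Fin (M + 1))) = ρ ≫ emb) →
    ∀ (π𝒳' : ((baseChangeHom σ).obj 𝒳₀).left ⟶ Y'),
      IsPullback π𝒳' ((baseChangeHom σ).map f₀).left g' πS' → π𝒳' ≫ ρ = π𝒳 →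
    -- the `q`-adic disc of the anchor on the enlarged model
    ∀ (q : ℕ) [Fact q.Prime] (κ : Type) [Field κ] [CharP κ q] [PerfectRing κ q] [IsAlgClosed κ]
      [Algebra (ZMod q) κ], Algebra.IsAlgebraic (ZMod q) κ →
    ∀ (β₀ β : B' →+* WittVector q κ) (ι' : K(q, κ) →+* ℂ)
      (s : ComplexPoints ((baseChangeHom σ).obj S₀)),
      n + 6 < q →
      β₀.comp (algebraMap R' B') = β.comp (algebraMap R' B') →
      (WittVector.constantCoeff : WittVector q κ →+* κ).comp β₀ =
        (WittVector.constantCoeff : WittVector q κ →+* κ).comp β →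
      ((ι'.comp (algebraMap (WittVector q κ) K(q, κ))).comp β₀).comp (algebraMap R' B') = τ' →
      s₀.left ≫ πS' =
        Spec.map (CommRingCat.ofHom ((ι'.comp (algebraMap (WittVector q κ) K(q, κ))).comp β₀)) →
      s.left ≫ πS' =
        Spec.map (CommRingCat.ofHom ((ι'.comp (algebraMap (WittVector q κ) K(q, κ))).comp β)) →
    -- the transport: a pro-class on the `W(κ)`-model of `X_s` whose algebraization settles `A|_{X_s}`
    ∃ ξ : ContinuousKZeroRat (Ideal.span {(q : WittVector q κ)})
        (Over.mk (pullback.snd g' (Spec.map (CommRingCat.ofHom β))) : SchemeOver (WittVector q κ)),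
      (∃ η : KZeroRat (pullback g' (Spec.map (CommRingCat.ofHom β))),
        KZeroRat.map (WittScheme.specialFibreι
          (Over.mk (pullback.snd g' (Spec.map (CommRingCat.ofHom β))) : SchemeOver (WittVector q κ)))
            η =
          KZeroRat.map (specialFibreToTower
            (Over.mk (pullback.snd g' (Spec.map (CommRingCat.ofHom β))) : SchemeOver (WittVector q κ)))
            (ContinuousKZeroRat.specialFibre (Ideal.span {(q : WittVector q κ)})
              (Over.mk (pullback.snd g' (Spec.map (CommRingCat.ofHom β))) :
                SchemeOver (WittVector q κ)) ξ)) →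
      complexBetti.map (fiberι ((baseChangeHom σ).map f₀) s) (2 * p) A ∈
        algebraicClasses (fiberOver ((baseChangeHom σ).map f₀) s) p)
 :
    Ring2.Hypotheses.VariationalHodgeQP :=
  variationalHodgeQP_of_padicQP hP
    fun N k _ _ σ _ _ _ f₀ h𝒳 hf hirr haff hsm hdim p A hA s₀ hs₀ =>
      arithmeticDiscSupplyQP_of_transport hT N k σ f₀ h𝒳 hf hirr haff hsm hdim p A hA s₀ hs₀

end Transport

end Summit.HodgeConjecture.HodgeConjecture.Theorems

end
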